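import Summits.QuantumFields.YangMills.Theses.FradkinShenkerFlow
import Summits.QuantumFields.YangMills.Theorems.SusceptibilityToPoincare.Negative.TwistSectorSimplyConnected
import Summits.QuantumFields.YangMills.Theorems.FradkinShenkerFlowSusceptibilityToPoincareTransfer
import Summits.QuantumFields.YangMills.Theorems.FradkinShenkerFlowSusceptibilityToPoincareElitzurBessel
import Summits.QuantumFields.YangMills.Theorems.FradkinShenkerFlowSusceptibilityToPoincareGibbsSparseEfronStein
import Summits.QuantumFields.YangMills.Theorems.FradkinShenkerFlowSusceptibilityToPoincareSparseTerminal

/-!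
# `SusceptibilityToPoincare` — negative side: the open stub of line `planted-link-pinning` (v2) inherits the twist bottleneck

Negative-side support for crux `stmt-QuantumFields-9441`
(`Summit.QuantumFields.YangMills.Theses.FradkinShenkerFlow.SusceptibilityToPoincare`, FS ⇒ UP) and for the
lead's line `Cruxes/SusceptibilityToPoincare/Lines/planted_link_pinning.lean` (skeleton v2, lead
`prover-line-stmt-QuantumFields-9441-c1-0`). Its only positive open stub is S4 `stub_sparseLocalToGlobal` — the
SPARSE PLANTED LOCAL-TO-GLOBAL inequality: for compact simple SIMPLY-CONNECTED `G`, faithful unitary `r`, EVERY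
`β ≥ 0`, Elitzur–Bessel + finite susceptibility imply `Var_μ F ≤ C · (L⁴)⁻¹ Σ_{i,a} ∫ (F − μ[F | links off
Φ_{a,i}])² dμ` for all `S ≥ 1` and all gauge-invariant bounded measurable `F` (`Φ_{a,i}` the uniformly translated
isolated link family `{(x,i) : (x ν − a ν).val odd ∀ν}`).

This file records, kernel-checked, that S4 AS TYPED (`∀ β ≥ 0`, all faithful `r`) is refuted by the SAME SU(2)
mixed-action twist-sector inputs `hW` that refute stub (4a) of line orbit-slice-reduction and the disprover's repaired
statement `C′` (`Negative/TwistSectorSimplyConnected.lean`, p77766): with the three LANDED provable stubs of the line —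
S2 Elitzur–Bessel (`ElitzurBessel.stub_elitzurBessel`, p99498), T0 sparse Efron–Stein for Gibbsian kernels
(`stub_gibbsSparseEfronStein`, p101717), T1 sparse terminal stage (`stub_sparseTerminal`, p104414) — and the
per-volume inequality at `S = 0` (`perVolume_heatBathPoincare`), S4 implies (4a) pointwise in `(G, r, β)`
(`stub4a_of_sparseLocalToGlobal`, both statements written out verbatim — S4 as registered on the item 2026-08-16T11:48Z, (4a) as negated in
`Negative/TwistSectorSimplyConnected.lean`), hence `hW → ¬ S4` (`stub_sparseLocalToGlobal_false_of_twistInputsSU2`).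

Consequence for the planner (same as every seat's): the crux and S4 must be re-typed with a coupling threshold,
`IsCompactSimpleLieGroup G → SimplyConnectedSpace G → ∀ r, ∃ β₁, ∀ β ≥ β₁, …`; the witness (`β` small, `r` reducible
with a weakly coupled centre-faithful summand) misses that form, and S2/T0/T1 and the transfer apply to it verbatim
(they are pointwise in `(G, r, β)`).

Nothing here asserts a Theses statement positively. Sorry count: 0.
-/

noncomputable section

open MeasureTheory ProbabilityTheory Filter Topology
open Literature.MathematicalPhysics.QuantumFieldTheory

namespace Summit.QuantumFields.YangMills.Theorems.SusceptibilityToPoincare.Negative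

/-- **S4 implies (4a), pointwise in `(G, r, β)`**, through the three landed provable stubs of the line: S2
Elitzur–Bessel feeds S4's hypothesis `EB`; T1 (fed with T0) bounds the sparse planted conditional variance by `½ ℰ_hb`;
the side `S = 0` is the landed per-volume inequality. So `Var F ≤ max(C_M · C_T, C₀) ℰ_hb(F)` for every gauge-invariant
bounded measurable `F` on every torus. [folklore] -/
theorem stub4a_of_sparseLocalToGlobal
    (h4 : ∀ (G : Type) [Group G] [TopologicalSpace G] [IsTopologicalGroup G] [CompactSpace G]
      [MeasurableSpace G] [BorelSpace G],
      Literature.MathematicalPhysics.QuantumFieldTheory.IsCompactSimpleLieGroup G →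
      SimplyConnectedSpace G →
      ∀ (r : Literature.MathematicalPhysics.QuantumFieldTheory.LatticeRep G) (β : ℝ), 0 ≤ β →
      (∀ S : ℕ, 1 ≤ S →
      ∀ φ : Literature.MathematicalPhysics.QuantumFieldTheory.GaugeConfig 4 (2 * S + 1) G → ℝ,
      Measurable φ → (∃ M : ℝ, ∀ U, |φ U| ≤ M) →
      ∑ ℓ : Literature.MathematicalPhysics.QuantumFieldTheory.Edge 4 (2 * S + 1),
      ProbabilityTheory.variance
      ((Literature.MathematicalPhysics.QuantumFieldTheory.wilsonMeasure (d := 4)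
      (L := 2 * S + 1) r.ρ β)[φ |
      MeasurableSpace.comap
      (fun V : Literature.MathematicalPhysics.QuantumFieldTheory.GaugeConfig 4
      (2 * S + 1) G => V ℓ) inferInstance])
      (Literature.MathematicalPhysics.QuantumFieldTheory.wilsonMeasure (d := 4)
      (L := 2 * S + 1) r.ρ β) ≤
      ProbabilityTheory.variance φ
      (Literature.MathematicalPhysics.QuantumFieldTheory.wilsonMeasure (d := 4)
      (L := 2 * S + 1) r.ρ β)) →
      (∀ A B : Literature.MathematicalPhysics.QuantumFieldTheory.YMSpecies G, ∃ χ : ℝ, ∀ S : ℕ,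
      ∑ x ∈ Literature.Probability.LatticeModels.box 4 S,
      |ProbabilityTheory.covariance
      (fun U => A.F (Literature.MathematicalPhysics.QuantumLattice.torusLift (2 * S + 1) U))
      (fun U => B.F (Literature.MathematicalPhysics.QuantumLattice.configShift (-x)
      (Literature.MathematicalPhysics.QuantumLattice.torusLift (2 * S + 1) U)))
      (Literature.MathematicalPhysics.QuantumFieldTheory.wilsonMeasure (d := 4)
      (L := 2 * S + 1) r.ρ β)| ≤ χ) →
      ∃ C : ℝ, 0 ≤ C ∧ ∀ (S : ℕ), 1 ≤ S →
      ∀ (F : Literature.MathematicalPhysics.QuantumFieldTheory.GaugeConfig 4 (2 * S + 1) G → ℝ),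
      Measurable F → (∃ M : ℝ, ∀ U, |F U| ≤ M) →
      Literature.MathematicalPhysics.QuantumFieldTheory.IsGaugeInvariant F →
      ProbabilityTheory.variance F
      (Literature.MathematicalPhysics.QuantumFieldTheory.wilsonMeasure (d := 4)
      (L := 2 * S + 1) r.ρ β) ≤
      C * ((((2 * S + 1) ^ 4 : ℕ) : ℝ)⁻¹ *
      ∑ i : Fin 4, ∑ a : Literature.MathematicalPhysics.QuantumFieldTheory.Site 4 (2 * S + 1),
      ∫ U, (F U - ((Literature.MathematicalPhysics.QuantumFieldTheory.wilsonMeasure (d := 4)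
      (L := 2 * S + 1) r.ρ β)[F | MeasureTheory.cylinderEvents
      (X := fun _ : Literature.MathematicalPhysics.QuantumFieldTheory.Edge 4 (2 * S + 1)
      => G)
      {ℓ : Literature.MathematicalPhysics.QuantumFieldTheory.Edge 4 (2 * S + 1) |
      ℓ.2 = i ∧ ∀ ν, Odd (ℓ.1 ν - a ν).val}ᶜ]) U) ^ 2
      ∂(Literature.MathematicalPhysics.QuantumFieldTheory.wilsonMeasure (d := 4)
      (L := 2 * S + 1) r.ρ β))) :
    (∀ (G : Type) [Group G] [TopologicalSpace G] [IsTopologicalGroup G] [CompactSpace G]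
      [MeasurableSpace G] [BorelSpace G], IsCompactSimpleLieGroup G → SimplyConnectedSpace G →
      ∀ (r : LatticeRep G) (β : ℝ), 0 ≤ β →
      (∀ A B : YMSpecies G, ∃ χ : ℝ, ∀ S : ℕ, ∑ x ∈ Literature.Probability.LatticeModels.box 4 S,
      |covariance (fun U => A.F (Literature.MathematicalPhysics.QuantumLattice.torusLift (2 * S + 1) U))
      (fun U => B.F (Literature.MathematicalPhysics.QuantumLattice.configShift (-x)
      (Literature.MathematicalPhysics.QuantumLattice.torusLift (2 * S + 1) U)))
      (wilsonMeasure r.ρ β : Measure (GaugeConfig 4 (2 * S + 1) G))| ≤ χ) →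
      ∃ C : ℝ, ∀ S : ℕ, ∀ F : GaugeConfig 4 (2 * S + 1) G → ℝ, Measurable F → (∃ M : ℝ, ∀ U, |F U| ≤ M) →
      IsGaugeInvariant F →
      variance F (wilsonMeasure r.ρ β : Measure (GaugeConfig 4 (2 * S + 1) G)) ≤
      C * ∑ ℓ : Edge 4 (2 * S + 1), ∫ U, ∫ g, (F U - F (Function.update U ℓ g)) ^ 2
      ∂((haarProbability G).tilted (fun g' => -β * wilsonAction r.ρ (Function.update U ℓ g')))
      ∂(wilsonMeasure r.ρ β : Measure (GaugeConfig 4 (2 * S + 1) G))) := by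
  intro G _ _ _ _ _ _ hG hsc r β hβ hFS
  obtain ⟨CM, hCM, hM⟩ := h4 G hG hsc r β hβ (ElitzurBessel.stub_elitzurBessel G r β) hFS
  obtain ⟨CT, -, hT⟩ := stub_sparseTerminal G r β stub_gibbsSparseEfronStein
  obtain ⟨C₀, hC₀⟩ := perVolume_heatBathPoincare G r β 0
  refine ⟨max (CM * CT) C₀, fun S F hF hB hI => ?_⟩
  have hnn := Transfer.hbForm_nonneg r β S F
  rcases Nat.eq_zero_or_pos S with hS | hS
  · subst hS
    exact (hC₀ F hF hB).trans (mul_le_mul_of_nonneg_right (le_max_right _ _) hnn)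
  · calc variance F (wilsonMeasure r.ρ β : Measure (GaugeConfig 4 (2 * S + 1) G))
        ≤ CM * _ := hM S hS F hF hB hI
      _ ≤ CM * (CT * _) := mul_le_mul_of_nonneg_left (hT S F hF hB) hCM
      _ = (CM * CT) * _ := by ring
      _ ≤ max (CM * CT) C₀ * _ := mul_le_mul_of_nonneg_right (le_max_left _ _) hnn

/-- **stub-misstated (as typed) modulo SU(2) twist inputs**: `SimplyConnectedSpace SU(2)` and the SU(2) mixed-action
twist-sector inputs `hW` of `Negative/TwistSectorSimplyConnected.lean` (FS at some admissible `(r, β ≥ 0)` together with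
gauge-invariant measurable events of non-degenerate mass and vanishing single-link heat-bath flux — the expected physics
of `r = ρ_{1/2} ⊕ k ρ₁` in the Bhanot–Creutz window) refute stub S4 of line planted-link-pinning AS TYPED (`∀ β ≥ 0`,
all faithful `r`). The repaired form (`∀ r, ∃ β₁, ∀ β ≥ β₁, …`) is not touched. [cite: BhanotCreutz1981]
[cite: DeforcrandJahn2003, §§4–5 (hep-lat/0211004)] -/
theorem stub_sparseLocalToGlobal_false_of_twistInputsSU2
    (hSC : SimplyConnectedSpace (Matrix.specialUnitaryGroup (Fin 2) ℂ))
    (hW : ∃ (r : LatticeRep (Matrix.specialUnitaryGroup (Fin 2) ℂ)) (β : ℝ), 0 ≤ β ∧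
      (∀ A B : YMSpecies (Matrix.specialUnitaryGroup (Fin 2) ℂ), ∃ χ : ℝ, ∀ S : ℕ,
        ∑ x ∈ Literature.Probability.LatticeModels.box 4 S,
        |covariance (fun U => A.F (Literature.MathematicalPhysics.QuantumLattice.torusLift (2 * S + 1) U))
          (fun U => B.F (Literature.MathematicalPhysics.QuantumLattice.configShift (-x)
          (Literature.MathematicalPhysics.QuantumLattice.torusLift (2 * S + 1) U)))
          (wilsonMeasure (d := 4) (L := 2 * S + 1) r.ρ β)| ≤ χ) ∧
      ∃ δ : ℝ, 0 < δ ∧ ∃ A : (∀ S : ℕ, Set (GaugeConfig 4 (2 * S + 1) (Matrix.specialUnitaryGroup (Fin 2) ℂ))),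
        (∀ S, MeasurableSet (A S)) ∧
        (∀ S, IsGaugeInvariant ((A S).indicator
          (1 : GaugeConfig 4 (2 * S + 1) (Matrix.specialUnitaryGroup (Fin 2) ℂ) → ℝ))) ∧
        (∀ S, δ ≤ (wilsonMeasure (d := 4) (L := 2 * S + 1) r.ρ β).real (A S) ∧
          (wilsonMeasure (d := 4) (L := 2 * S + 1) r.ρ β).real (A S) ≤ 1 - δ) ∧
        Tendsto (fun S : ℕ => ∑ ℓ : Edge 4 (2 * S + 1), ∫ U, ∫ g,
            ((A S).indicator (1 : GaugeConfig 4 (2 * S + 1) (Matrix.specialUnitaryGroup (Fin 2) ℂ) → ℝ) U -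
              (A S).indicator 1 (Function.update U ℓ g)) ^ 2
          ∂((haarProbability (Matrix.specialUnitaryGroup (Fin 2) ℂ)).tilted
              (fun g' => -β * wilsonAction r.ρ (Function.update U ℓ g')))
          ∂(wilsonMeasure (d := 4) (L := 2 * S + 1) r.ρ β)) atTop (𝓝 0)) :
    ¬ (∀ (G : Type) [Group G] [TopologicalSpace G] [IsTopologicalGroup G] [CompactSpace G]
      [MeasurableSpace G] [BorelSpace G],
      Literature.MathematicalPhysics.QuantumFieldTheory.IsCompactSimpleLieGroup G →
      SimplyConnectedSpace G →
      ∀ (r : Literature.MathematicalPhysics.QuantumFieldTheory.LatticeRep G) (β : ℝ), 0 ≤ β →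
      (∀ S : ℕ, 1 ≤ S →
      ∀ φ : Literature.MathematicalPhysics.QuantumFieldTheory.GaugeConfig 4 (2 * S + 1) G → ℝ,
      Measurable φ → (∃ M : ℝ, ∀ U, |φ U| ≤ M) →
      ∑ ℓ : Literature.MathematicalPhysics.QuantumFieldTheory.Edge 4 (2 * S + 1),
      ProbabilityTheory.variance
      ((Literature.MathematicalPhysics.QuantumFieldTheory.wilsonMeasure (d := 4)
      (L := 2 * S + 1) r.ρ β)[φ |
      MeasurableSpace.comap
      (fun V : Literature.MathematicalPhysics.QuantumFieldTheory.GaugeConfig 4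
      (2 * S + 1) G => V ℓ) inferInstance])
      (Literature.MathematicalPhysics.QuantumFieldTheory.wilsonMeasure (d := 4)
      (L := 2 * S + 1) r.ρ β) ≤
      ProbabilityTheory.variance φ
      (Literature.MathematicalPhysics.QuantumFieldTheory.wilsonMeasure (d := 4)
      (L := 2 * S + 1) r.ρ β)) →
      (∀ A B : Literature.MathematicalPhysics.QuantumFieldTheory.YMSpecies G, ∃ χ : ℝ, ∀ S : ℕ,
      ∑ x ∈ Literature.Probability.LatticeModels.box 4 S,
      |ProbabilityTheory.covariance
      (fun U => A.F (Literature.MathematicalPhysics.QuantumLattice.torusLift (2 * S + 1) U))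
      (fun U => B.F (Literature.MathematicalPhysics.QuantumLattice.configShift (-x)
      (Literature.MathematicalPhysics.QuantumLattice.torusLift (2 * S + 1) U)))
      (Literature.MathematicalPhysics.QuantumFieldTheory.wilsonMeasure (d := 4)
      (L := 2 * S + 1) r.ρ β)| ≤ χ) →
      ∃ C : ℝ, 0 ≤ C ∧ ∀ (S : ℕ), 1 ≤ S →
      ∀ (F : Literature.MathematicalPhysics.QuantumFieldTheory.GaugeConfig 4 (2 * S + 1) G → ℝ),
      Measurable F → (∃ M : ℝ, ∀ U, |F U| ≤ M) →
      Literature.MathematicalPhysics.QuantumFieldTheory.IsGaugeInvariant F →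
      ProbabilityTheory.variance F
      (Literature.MathematicalPhysics.QuantumFieldTheory.wilsonMeasure (d := 4)
      (L := 2 * S + 1) r.ρ β) ≤
      C * ((((2 * S + 1) ^ 4 : ℕ) : ℝ)⁻¹ *
      ∑ i : Fin 4, ∑ a : Literature.MathematicalPhysics.QuantumFieldTheory.Site 4 (2 * S + 1),
      ∫ U, (F U - ((Literature.MathematicalPhysics.QuantumFieldTheory.wilsonMeasure (d := 4)
      (L := 2 * S + 1) r.ρ β)[F | MeasureTheory.cylinderEvents
      (X := fun _ : Literature.MathematicalPhysics.QuantumFieldTheory.Edge 4 (2 * S + 1)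
      => G)
      {ℓ : Literature.MathematicalPhysics.QuantumFieldTheory.Edge 4 (2 * S + 1) |
      ℓ.2 = i ∧ ∀ ν, Odd (ℓ.1 ν - a ν).val}ᶜ]) U) ^ 2
      ∂(Literature.MathematicalPhysics.QuantumFieldTheory.wilsonMeasure (d := 4)
      (L := 2 * S + 1) r.ρ β))) := fun h4 =>
  stub_fsPoincareInv_simplyConnected_false_of_twistInputsSU2 hSC hW (stub4a_of_sparseLocalToGlobal h4)

end Summit.QuantumFields.YangMills.Theorems.SusceptibilityToPoincare.Negative
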